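import Summits.Langlands.Langlands.Theses.HolomorphicShadow
import Summits.Langlands.Langlands.Theorems.IrreducibilityBySelfDualityReciprocityUpToIrreducibilityGeometricConstituents
import Summits.Langlands.Langlands.Theorems.IrreducibilityBySelfDualityReciprocityUpToIrreducibilityDeRhamBlocks
import Summits.Langlands.Langlands.Theorems.IrreducibilityBySelfDualityReciprocityUpToIrreducibilityIsobaricRigidity
import Summits.Langlands.Langlands.Theorems.IrreducibilityBySelfDualityIrreducibleGL3CMContinuousSemisimplification
import Summits.Langlands.Langlands.Theorems.IrreducibilityBySelfDualityIrreducibleGL3CMReducibleCompanion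
import Literature.NumberTheory.GaloisRepresentations.LAdicRepFrobenius
import Literature.NumberTheory.GaloisRepresentations.FramedRepEquivConj
import Literature.NumberTheory.Automorphic.ChebotarevArtinRepHolds
import Literature.NumberTheory.Automorphic.AutomorphicRepsGLSatakeFlathProofs
import Literature.NumberTheory.Automorphic.IsAutomorphicAE
import Literature.NumberTheory.Automorphic.GLnAdelicStructureProofs
import HarnessLib

/-!
# SKELETON — line `pieces` for the crux `HolomorphicShadow.SectorComplement` (stmt-Langlands-14623)
(crux-strategist planner-cstrat-stmt-Langlands-14623-r1-0, 2026-08-17; output (a) of the strategist protocol — the typed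
decomposition D★ of the BC2 redirect, registered as a LINE because `route edit --split` is gated to final cycles)

The crux is the route's junction `SectorComplement := H → _root_.Langlands` (H = the even-Maass slice).  The five REGISTERED STUBS are
the five typed pieces of D★ (texts byte-identical with `children.json` / `Sketch.lean` / the pre-split stand-ins of
`Lines/SectorComplementOfPieces.lean`):

* `stub_weakExistence` — W, Buzzard–Gee Conj. 3.2.2 weak form (OPEN: irregular `π`, general `K`);
* `stub_weakAutomorphyOffEvenArtin` — B⁻, Fontaine–Mazur–Langlands a.e. OFF the even Artin plane (OPEN);
* `stub_evenArtinPlaneOfMaass` — B⁺ = `H →` weak automorphy ON the plane: THE STUB THAT CONSUMES `H` (true in substance, size L: Artin data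
  13896 + Maass dictionary 13895 + L-algebraicity + `ι`-dual transport; its own birth skeleton `Lines/birth_HolomorphicShadow_EvenArtinPlaneOfMaass.lean`);
* `stub_pairCompatibilityAllData` — LGC∀ = `Nonempty (ReciprocityData K)` ∧ Taylor Conj. 7 at every place for EVERY pinned datum (OPEN; =
  LGC∃ + rigidity R, the live line on stmt-Langlands-18745);
* `stub_isobaricRigidityUnramified` — IR, Jacquet–Shalika II Thm. 4.4 (KNOWN; one line from the route's items PairLBoundaryJS ∧ PairLPoleJS by
  the landed `stub_isobaricRigidity`, see `isobaricRigidityUnramified_of_JS` below).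

`SectorComplement_of` (kernel-checked, no `sorry`; hypotheses = the five stub statements by name via `_Goal.stub_x := type_of% @stub_x`) is
the ∀𝓡 assembly of `Lines/SectorComplementOfPieces.lean` verbatim: case split on the plane (B⁺ fed with `hH`, B⁻ elsewhere); isobaric
bootstrap (`stub_geometricConstituents` p99702 + `stub_deRhamBlocks` p98936, closed off by IR); per-datum (A) ∧ (B) through LGC∀;
(A)-uniqueness by Chebotarev–Brauer–Nesbitt through a continuous semisimplification.  It supersedes `Lines/birth.lean` (planner-skel,
03:19Z), whose composition ends in the pre-re-type `∃ Rec` seam `langlands_of_reciprocityUpToIrreducibility_text_of_JS` that no longer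
elaborates from source against the re-typed summit p141787 (stale olean).  `lean check`: sorries = the five stubs, nothing else.

Disproof used: none exists for this item (the shared `Disproof.lean` PARTS I/II concern 18275/18745; no `_false_without_H` short of
`¬Langlands`; no `Theorems/SectorComplement/Negative/` lemma mentions HolomorphicShadow).  Dead lines: none recorded.

References: as in `Lines/SectorComplementOfPieces.lean` (BuzzardGeeLMS2014, FontaineMazurGeometric1995, TaylorGaloisRepresentations2004,
ArthurClozelAMS120, CalegariGee2013, DeligneSerreASENS1974, Henniarts1993, HarrisTaylorAMS2001, JacquetShalikaAJM1981II).
-/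

noncomputable section

set_option linter.dupNamespace false -- project-wide option; `Summit.Langlands.Langlands` is the mandated namespace

open scoped NumberField Classical Polynomial
open Filter IsDedekindDomain Polynomial
open Literature.NumberTheory.Automorphic Literature.NumberTheory.GaloisRepresentations
open Summit.Langlands
open Summit.Langlands.Langlands.Theorems.ReciprocityUpToIrreducibility
open Summit.Langlands.Langlands.Theses.HolomorphicShadow (SectorComplement PairLBoundaryJS PairLPoleJS)

namespace Summit.Langlands.Langlands.Cruxes.SectorComplement.Pieces

/-! ## 1. The five stubs (the ONLY sorries of this file) — stated in the ROUTE FILE's context (same `open`s), texts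
byte-identical with the children; the section keeps `Manifold`'s `𝓡` notation away from the composition below. -/

section StubTexts

open scoped BigOperators Topology Manifold Classical MeasureTheory ProbabilityTheory Matrix InnerProductSpace ComplexConjugate ContinuousMap
open Filter Set Function TopologicalSpace MeasureTheory


/-- **stub W — weak existence** (Buzzard–Gee Conj. 3.2.2, weak form; OPEN for irregular `π` and general `K`).
[cite: BuzzardGeeLMS2014, Conj. 3.2.2] [cite: HarrisLanTaylorThorneRMS2016, Thm. A] -/
theorem stub_weakExistence : ∀ (K : Type) [Field K] [NumberField K] (n : ℕ) (hcpt : Literature.NumberTheory.Automorphic.isCompact_glFiniteIntegralLevel n K), 0 < n → ∀ π : Literature.NumberTheory.Automorphic.CuspidalAutomorphicRepData n K hcpt, π.1.IsLAlgebraic → ∀ (ℓ : ℕ) [Fact ℓ.Prime] (ι : PadicAlgCl ℓ ≃+* ℂ), ∃ ρ : Literature.NumberTheory.GaloisRepresentations.FramedGaloisRep K (PadicAlgCl ℓ) n, ((∀ᶠ v : IsDedekindDomain.HeightOneSpectrum (NumberField.RingOfIntegers K) in cofinite, ρ.IsUnramifiedAt v) ∧ ∀ (v : IsDedekindDomain.HeightOneSpectrum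 (NumberField.RingOfIntegers K)) (hv : ((ℓ : ℕ) : NumberField.RingOfIntegers K) ∈ v.asIdeal), (Literature.NumberTheory.PAdicHodge.fontainePstAdicCompletion v ℓ hv).IsDeRhamFramed (ρ.toLocal v)) ∧ ∀ᶠ v : IsDedekindDomain.HeightOneSpectrum (NumberField.RingOfIntegers K) in cofinite, SatakeFrobCompatibleAt ι π.1 ρ v := by
  sorry

/-- **stub B⁻ — weak automorphy OFF the even Artin plane** (Fontaine–Mazur Conj. 1 + Langlands, a.e. form; OPEN).
[cite: FontaineMazurGeometric1995, Conj. 1] [cite: KhareWintenberger2009, Thm. 1.2] -/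
theorem stub_weakAutomorphyOffEvenArtin : ∀ (K : Type) [Field K] [NumberField K] (n : ℕ) (hcpt : Literature.NumberTheory.Automorphic.isCompact_glFiniteIntegralLevel n K), 0 < n → ∀ (ℓ : ℕ) [Fact ℓ.Prime] (ι : PadicAlgCl ℓ ≃+* ℂ) (ρ : Literature.NumberTheory.GaloisRepresentations.FramedGaloisRep K (PadicAlgCl ℓ) n), ρ.toGaloisRep.IsIrreducible → ((∀ᶠ v : IsDedekindDomain.HeightOneSpectrum (NumberField.RingOfIntegers K) in cofinite, ρ.IsUnramifiedAt v) ∧ ∀ (v : IsDedekindDomain.HeightOneSpectrum (NumberField.RingOfIntegers K)) (hv : ((ℓ : ℕ) : NumberField.RingOfIntegers K) ∈ v.asIdeal), (Literature.NumberTheory.PAdicHodge.fontainePstAdicCompletion v ℓ hv).IsDeRhamFramed (ρ.toLocal v)) → ¬ (Module.finrank ℚ K = 1 ∧ n = 2 ∧ IsOpen (ρ.toMonoidHom.ker : Set (Field.absoluteGaloisGroup K)) ∧ (∀ (φ : K →+* ℝ) (c : Field.absoluteGaloisGroup K), Literature.NumberTheory.GaloisRepresentations.IsComplexConjugation φ c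 → Matrix.GeneralLinearGroup.det (ρ c) = 1)) → ∃ π : Literature.NumberTheory.Automorphic.CuspidalAutomorphicRepData n K hcpt, π.1.IsLAlgebraic ∧ ∀ᶠ v : IsDedekindDomain.HeightOneSpectrum (NumberField.RingOfIntegers K) in cofinite, SatakeFrobCompatibleAt ι π.1 ρ v := by
  sorry

/-- **stub B⁺ — the even Artin plane from the even-Maass slice `H`** (THE STUB THAT USES `H`; true in substance, size L).
[cite: Gelbart1975, §3] [cite: BuzzardGeeLMS2014, Def. 3.1.1 and Conj. 3.2.2] -/
theorem stub_evenArtinPlaneOfMaass : let K0 : ℝ → ℝ := fun x => ∫ t in Set.Ioi (0 : ℝ), Real.exp (-(x * Real.cosh t)); let maass : (ℕ → ℂ) → ℂ → UpperHalfPlane → ℂ := fun a ε z => ∑' n : ℕ, a (n + 1) * ((Real.sqrt z.im * K0 (2 * Real.pi * ((n : ℝ) + 1) * z.im) : ℝ) : ℂ) * (Complex.exp (2 * Real.pi * Complex.I * ((n : ℂ) + 1) * (z.re : ℂ)) + ε * Complex.exp (-(2 * Real.pi * Complex.I * ((n : ℂ) + 1) * (z.re : ℂ)))); let EulerPin : Literature.NumberTheory.GaloisRepresentations.FramedGaloisRep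 ℚ ℂ 2 → (N : ℕ) → DirichletCharacter ℂ N → (ℕ → ℂ) → Prop := fun σ N χ a => a 1 = 1 ∧ (∀ m n : ℕ, Nat.Coprime m n → a (m * n) = a m * a n) ∧ (∀ p : ℕ, p.Prime → p ∣ N → ∀ j : ℕ, a (p ^ (j + 1)) = 0) ∧ (∀ p : ℕ, p.Prime → ¬ p ∣ N → (∀ j : ℕ, a (p ^ (j + 2)) = a p * a (p ^ (j + 1)) - χ (p : ZMod N) * a (p ^ j)) ∧ ∀ v : IsDedekindDomain.HeightOneSpectrum (NumberField.RingOfIntegers ℚ), (p : NumberField.RingOfIntegers ℚ) ∈ v.asIdeal → Literature.NumberTheory.GaloisRepresentations.FramedGaloisRep.IsUnramifiedAt v σ ∧ Literature.NumberTheory.GaloisRepresentations.FramedGaloisRep.HasFrobCharpolyAt v (Polynomial.X ^ 2 - Polynomial.C (a p) * Polynomial.X + Polynomial.C (χ (p : ZMod N))) σ); let ParityPin : Literature.NumberTheory.GaloisRepresentations.FramedGaloisRep ℚ ℂ 2 → ℂ → Prop := fun σ ε => ∀ (φ : ℚ →+* ℝ) (c : Field.absoluteGaloisGroup ℚ), Literature.NumberTheory.GaloisRepresentations.IsComplexConjugation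 φ c → ((σ c : GL (Fin 2) ℂ) : Matrix (Fin 2) (Fin 2) ℂ) = ε • (1 : Matrix (Fin 2) (Fin 2) ℂ); (∀ σ : Literature.NumberTheory.GaloisRepresentations.FramedGaloisRep ℚ ℂ 2, σ.toGaloisRep.IsIrreducible → ∀ (N : ℕ) (χ : DirichletCharacter ℂ N) (ε : ℂ) (a : ℕ → ℂ), 0 < N → (ε = 1 ∨ ε = -1) → ParityPin σ ε → (∃ C A : ℝ, ∀ n : ℕ, ‖a n‖ ≤ C * ((n : ℝ) + 1) ^ A) → EulerPin σ N χ a → ∃ L : ℕ, 0 < L ∧ N ∣ L ∧ ∀ γ ∈ CongruenceSubgroup.Gamma0 L, ∀ z : UpperHalfPlane, maass a ε (γ • z) = χ ((((γ : Matrix (Fin 2) (Fin 2) ℤ) 1 1 : ℤ) : ZMod N)) * maass a ε z) → ∀ (K : Type) [Field K] [NumberField K], Module.finrank ℚ K = 1 → ∀ (hcpt : Literature.NumberTheory.Automorphic.isCompact_glFiniteIntegralLevel 2 K) (ℓ : ℕ) [Fact ℓ.Prime] (ι : PadicAlgCl ℓ ≃+* ℂ) (ρ : Literature.NumberTheory.GaloisRepresentations.FramedGaloisRep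 K (PadicAlgCl ℓ) 2), ρ.toGaloisRep.IsIrreducible → IsOpen (ρ.toMonoidHom.ker : Set (Field.absoluteGaloisGroup K)) → (∀ (φ : K →+* ℝ) (c : Field.absoluteGaloisGroup K), Literature.NumberTheory.GaloisRepresentations.IsComplexConjugation φ c → Matrix.GeneralLinearGroup.det (ρ c) = 1) → ∃ π : Literature.NumberTheory.Automorphic.CuspidalAutomorphicRepData 2 K hcpt, π.1.IsLAlgebraic ∧ ∀ᶠ v : IsDedekindDomain.HeightOneSpectrum (NumberField.RingOfIntegers K) in cofinite, SatakeFrobCompatibleAt ι π.1 ρ v := by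
  sorry

/-- **stub LGC∀ — reciprocity data exist and every pinned datum is compatible everywhere** (Taylor 2004 Conj. 7 for every
Henniart-normalised `rec`; OPEN; = LGC∃ + rigidity of pinned data). [cite: TaylorGaloisRepresentations2004, Conj. 7]
[cite: HarrisTaylorAMS2001, Thm. A] [cite: Henniarts1993, Thm 1.1] -/
theorem stub_pairCompatibilityAllData : ∀ (K : Type) [Field K] [NumberField K], Nonempty (ReciprocityData K) ∧ ∀ (Rec : ReciprocityData K) (n : ℕ) (hcpt : Literature.NumberTheory.Automorphic.isCompact_glFiniteIntegralLevel n K), 0 < n → ∀ (π : Literature.NumberTheory.Automorphic.CuspidalAutomorphicRepData n K hcpt), π.1.IsLAlgebraic → ∀ (ℓ : ℕ) [Fact ℓ.Prime] (ι : PadicAlgCl ℓ ≃+* ℂ) (ρ : Literature.NumberTheory.GaloisRepresentations.FramedGaloisRep K (PadicAlgCl ℓ) n), ρ.toGaloisRep.IsIrreducible → ((∀ᶠ v : IsDedekindDomain.HeightOneSpectrum (NumberField.RingOfIntegers K) in cofinite, ρ.IsUnramifiedAt v) ∧ ∀ (v : IsDedekindDomain.HeightOneSpectrum (NumberField.RingOfIntegers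 K)) (hv : ((ℓ : ℕ) : NumberField.RingOfIntegers K) ∈ v.asIdeal), (Literature.NumberTheory.PAdicHodge.fontainePstAdicCompletion v ℓ hv).IsDeRhamFramed (ρ.toLocal v)) → (∀ᶠ v : IsDedekindDomain.HeightOneSpectrum (NumberField.RingOfIntegers K) in cofinite, SatakeFrobCompatibleAt ι π.1 ρ v) → ∀ v : IsDedekindDomain.HeightOneSpectrum (NumberField.RingOfIntegers K), LocalGlobalCompatibleAt Rec ι π.1 ρ v := by
  sorry

/-- **stub IR — isobaric rigidity at the unramified places** (Jacquet–Shalika II Thm. 4.4; KNOWN — from the route items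
PairLBoundaryJS ∧ PairLPoleJS by `stub_isobaricRigidity`, cf. `isobaricRigidityUnramified_of_JS`). [cite: JacquetShalikaAJM1981II, Thm. 4.4] -/
theorem stub_isobaricRigidityUnramified : ∀ (K : Type) [Field K] [NumberField K] (n : ℕ) (hcpt : Literature.NumberTheory.Automorphic.isCompact_glFiniteIntegralLevel n K) (π : Literature.NumberTheory.Automorphic.CuspidalAutomorphicRepData n K hcpt) (k : ℕ) (m : Fin k → ℕ) (hm : ∀ i, Literature.NumberTheory.Automorphic.isCompact_glFiniteIntegralLevel (m i) K) (σ : ∀ i, Literature.NumberTheory.Automorphic.CuspidalAutomorphicRepData (m i) K (hm i)), 0 < n → 2 ≤ k → (∀ i, 0 < m i) → ¬ ∀ᶠ v : IsDedekindDomain.HeightOneSpectrum (NumberField.RingOfIntegers K) in cofinite, ∀ α : Multiset ℂ, π.1.HasSatakeParamAt v α → ∃ β : Fin k → Multiset ℂ, (∀ i, (σ i).1.HasSatakeParamAt v (β i)) ∧ α = ∑ i, β i := by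
  sorry

end StubTexts

/-! ## 2. The stub statements as named propositions (hypotheses of the composition, admissible by stub name) -/

namespace _Goal

/-- The statement of `stub_weakExistence` (literally its type). [folklore] -/
def stub_weakExistence : Prop :=
  type_of% @Summit.Langlands.Langlands.Cruxes.SectorComplement.Pieces.stub_weakExistence

/-- The statement of `stub_weakAutomorphyOffEvenArtin` (literally its type). [folklore] -/
def stub_weakAutomorphyOffEvenArtin : Prop :=
  type_of% @Summit.Langlands.Langlands.Cruxes.SectorComplement.Pieces.stub_weakAutomorphyOffEvenArtin

/-- The statement of `stub_evenArtinPlaneOfMaass` (literally its type). [folklore] -/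
def stub_evenArtinPlaneOfMaass : Prop :=
  type_of% @Summit.Langlands.Langlands.Cruxes.SectorComplement.Pieces.stub_evenArtinPlaneOfMaass

/-- The statement of `stub_pairCompatibilityAllData` (literally its type). [folklore] -/
def stub_pairCompatibilityAllData : Prop :=
  type_of% @Summit.Langlands.Langlands.Cruxes.SectorComplement.Pieces.stub_pairCompatibilityAllData

/-- The statement of `stub_isobaricRigidityUnramified` (literally its type). [folklore] -/
def stub_isobaricRigidityUnramified : Prop :=
  type_of% @Summit.Langlands.Langlands.Cruxes.SectorComplement.Pieces.stub_isobaricRigidityUnramified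

end _Goal

/-! ## 3. Helpers and the composition (kernel-checked, no `sorry`) -/

variable {n : ℕ} {K : Type} [Field K] [NumberField K] {ℓ : ℕ} [Fact ℓ.Prime]

omit [NumberField K] in
/-- An irreducible continuous Galois representation on `ℚ̄_ℓⁿ` is semisimple. [folklore] -/
theorem isSemisimple_of_isIrreducible (ρ : FramedGaloisRep K (PadicAlgCl ℓ) n)
    (h : ρ.toGaloisRep.IsIrreducible) : ρ.toGaloisRep.IsSemisimple := by
  haveI := h
  change ComplementedLattice _
  infer_instance

omit [NumberField K] in
/-- Conjugate framed representations have the same characteristic polynomials. [folklore] -/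
theorem charpoly_conj (P : GL (Fin n) (PadicAlgCl ℓ)) (ρ : FramedGaloisRep K (PadicAlgCl ℓ) n)
    (g : Field.absoluteGaloisGroup K) :
    FramedRep.charpoly (ρ.conj P) g = FramedRep.charpoly ρ g := by
  simp only [FramedRep.charpoly, FramedRep.conj_apply, Units.val_mul, Matrix.coe_units_inv]
  exact Matrix.charpoly_units_conj P _

/-- **Chebotarev–Brauer–Nesbitt transfer of irreducibility** (Deligne–Serre 1974, Lemme 3.2; every rank, every
number field): if `ρ₀` is irreducible and `ρ₀`, `ρ` are unramified with a common Frobenius characteristic polynomial at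
almost all places, then `ρ` is irreducible AND conjugate to `ρ₀`.  (Re-proved here from the landed GL3CM lemmas; the
homonymous lemma of `…IrreducibleOffSectorTransfer` lives in a module whose other theorems destructure the pre-re-type
summit.) [cite: DeligneSerreASENS1974, Lemme 3.2] -/
theorem isIrreducible_and_isConjugate_of_common {ρ₀ ρ : FramedGaloisRep K (PadicAlgCl ℓ) n}
    (hirr₀ : ρ₀.toGaloisRep.IsIrreducible)
    (h : ∀ᶠ v : HeightOneSpectrum (𝓞 K) in cofinite,
      ρ₀.IsUnramifiedAt v ∧ ρ.IsUnramifiedAt v ∧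
        ∃ P : Polynomial (PadicAlgCl ℓ), ρ₀.HasFrobCharpolyAt v P ∧ ρ.HasFrobCharpolyAt v P) :
    ρ.toGaloisRep.IsIrreducible ∧ IsConjugate ρ₀ ρ := by
  -- a continuous semisimplification `r` of `ρ`, with the same hypothesis
  obtain ⟨r, hrss, hrcp, hrker⟩ := Summit.Langlands.Langlands.Theorems.IrreducibleGL3CM.stub_continuousSemisimplification K ℓ n ρ
  have hr : ∀ᶠ v : HeightOneSpectrum (𝓞 K) in cofinite,
      ρ₀.IsUnramifiedAt v ∧ r.IsUnramifiedAt v ∧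
        ∃ P : Polynomial (PadicAlgCl ℓ), ρ₀.HasFrobCharpolyAt v P ∧ r.HasFrobCharpolyAt v P := by
    filter_upwards [h] with v hv
    obtain ⟨hur₀, hur, P, hcp₀, hcp⟩ := hv
    exact ⟨hur₀, fun 𝔓 h𝔓 σ hσ => hrker σ (hur 𝔓 h𝔓 σ hσ), P, hcp₀,
      fun 𝔓 h𝔓 σ hσ => (hrcp σ).trans (hcp 𝔓 h𝔓 σ hσ)⟩
  -- `ρ₀ ≃ r` (Chebotarev + Brauer–Nesbitt), hence `r` is a conjugate of `ρ₀`
  obtain ⟨e⟩ := FramedGaloisRep.nonempty_equiv_of_hasFrobCharpolyAt_eventually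
    chebotarev_artinRep_holds ρ₀ r (isSemisimple_of_isIrreducible ρ₀ hirr₀) hrss hr
  obtain ⟨P, hP⟩ := FramedRep.exists_eq_conj_of_equiv ρ₀ r e
  -- equal characteristic polynomials everywhere, and Brauer–Nesbitt: `ρ` is irreducible
  have hcp : ∀ g, FramedRep.charpoly ρ₀ g = FramedRep.charpoly ρ g := fun g => by
    rw [← hrcp g, hP, charpoly_conj]
  have hirr : ρ.toGaloisRep.IsIrreducible := by
    by_contra hirr
    exact Summit.Langlands.Langlands.Theorems.IrreducibleGL3CM.stub_not_isIrreducible_of_charpoly_eq K ℓ n ρ ρ₀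
      (isSemisimple_of_isIrreducible ρ₀ hirr₀) hcp hirr hirr₀
  -- so `ρ` itself is semisimple and equivalent, hence conjugate, to `ρ₀`
  refine ⟨hirr, ?_⟩
  obtain ⟨e'⟩ := FramedGaloisRep.nonempty_equiv_of_hasFrobCharpolyAt_eventually
    chebotarev_artinRep_holds ρ₀ ρ (isSemisimple_of_isIrreducible ρ₀ hirr₀) (isSemisimple_of_isIrreducible ρ hirr) h
  obtain ⟨Q, hQ⟩ := FramedRep.exists_eq_conj_of_equiv ρ₀ ρ e'
  exact ⟨Q, hQ.symm⟩

/-- `arithFrobPolyOfSatake` of a finite sum of multisets is the product (re-proved; cf. `IrreducibleOffSector`). [folklore] -/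
theorem arithFrobPolyOfSatake_sum (ι : PadicAlgCl ℓ ≃+* ℂ) (q m : ℕ) {k : ℕ} (β : Fin k → Multiset ℂ) :
    arithFrobPolyOfSatake ι q m (∑ i, β i) = ∏ i, arithFrobPolyOfSatake ι q m (β i) := by
  classical
  induction k with
  | zero => simp [arithFrobPolyOfSatake]
  | succ k ih =>
    rw [Fin.sum_univ_castSucc, Fin.prod_univ_castSucc, ← ih]
    simp [arithFrobPolyOfSatake, Multiset.map_add, Multiset.prod_add]

/-- **`SectorComplement` from its five stubs** — the ∀𝓡 assembly (verbatim `sectorComplement_of_pieces` of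
`Lines/SectorComplementOfPieces.lean`).  Hypotheses = the five stub statements by name; conclusion = the route decl BY NAME.  [cite: BuzzardGeeLMS2014, Conj. 3.2.1 and Conj. 3.2.2]
[cite: ArthurClozelAMS120, Ch. 3 §2 (2.2)–(2.3)] [cite: CalegariGee2013, §1.1] [cite: DeligneSerreASENS1974, Lemme 3.2] -/
theorem SectorComplement_of (hW : _Goal.stub_weakExistence) (hOff : _Goal.stub_weakAutomorphyOffEvenArtin)
    (hOn : _Goal.stub_evenArtinPlaneOfMaass) (hL : _Goal.stub_pairCompatibilityAllData)
    (hIR : _Goal.stub_isobaricRigidityUnramified) : SectorComplement := by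
  dsimp only [_Goal.stub_weakExistence, _Goal.stub_weakAutomorphyOffEvenArtin, _Goal.stub_evenArtinPlaneOfMaass,
    _Goal.stub_pairCompatibilityAllData, _Goal.stub_isobaricRigidityUnramified] at hW hOff hOn hL hIR
  intro hH
  -- B_w (Fontaine–Mazur–Langlands, a.e. form) from its two halves: the even Artin plane is discharged by `H`
  have hB : ∀ (K : Type) [Field K] [NumberField K] (n : ℕ) (hcpt : isCompact_glFiniteIntegralLevel n K), 0 < n →
      ∀ (ℓ : ℕ) [Fact ℓ.Prime] (ι : PadicAlgCl ℓ ≃+* ℂ) (ρ : FramedGaloisRep K (PadicAlgCl ℓ) n),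
        ρ.toGaloisRep.IsIrreducible → ((∀ᶠ v : IsDedekindDomain.HeightOneSpectrum (NumberField.RingOfIntegers K) in cofinite, ρ.IsUnramifiedAt v) ∧ ∀ (v : IsDedekindDomain.HeightOneSpectrum (NumberField.RingOfIntegers K)) (hv : ((ℓ : ℕ) : NumberField.RingOfIntegers K) ∈ v.asIdeal), (Literature.NumberTheory.PAdicHodge.fontainePstAdicCompletion v ℓ hv).IsDeRhamFramed (ρ.toLocal v)) →
          ∃ π : CuspidalAutomorphicRepData n K hcpt, π.1.IsLAlgebraic ∧
            ∀ᶠ v : HeightOneSpectrum (𝓞 K) in cofinite, SatakeFrobCompatibleAt ι π.1 ρ v := by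
    intro K _ _ n hcpt hn ℓ _ ι ρ hirr hgeo
    by_cases hs : (Module.finrank ℚ K = 1 ∧ n = 2 ∧ IsOpen (ρ.toMonoidHom.ker : Set (Field.absoluteGaloisGroup K)) ∧ (∀ (φ : K →+* ℝ) (c : Field.absoluteGaloisGroup K), Literature.NumberTheory.GaloisRepresentations.IsComplexConjugation φ c → Matrix.GeneralLinearGroup.det (ρ c) = 1))
    · obtain ⟨hK, rfl, hker, hev⟩ := hs
      exact hOn hH K hK hcpt ℓ ι ρ hirr hker hev
    · exact hOff K n hcpt hn ℓ ι ρ hirr hgeo hs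
  -- the isobaric bootstrap, run with B_w: a pinned-geometric a.e.-avatar of a cuspidal `π` is irreducible
  have irr : ∀ (K : Type) [Field K] [NumberField K] (n : ℕ) (hcpt : isCompact_glFiniteIntegralLevel n K)
      (_ : 0 < n) (π : CuspidalAutomorphicRepData n K hcpt) (ℓ : ℕ) [Fact ℓ.Prime]
      (ι : PadicAlgCl ℓ ≃+* ℂ) (ρ : FramedGaloisRep K (PadicAlgCl ℓ) n),
      ((∀ᶠ v : IsDedekindDomain.HeightOneSpectrum (NumberField.RingOfIntegers K) in cofinite, ρ.IsUnramifiedAt v) ∧ ∀ (v : IsDedekindDomain.HeightOneSpectrum (NumberField.RingOfIntegers K)) (hv : ((ℓ : ℕ) : NumberField.RingOfIntegers K) ∈ v.asIdeal), (Literature.NumberTheory.PAdicHodge.fontainePstAdicCompletion v ℓ hv).IsDeRhamFramed (ρ.toLocal v)) →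
      (∀ᶠ v : HeightOneSpectrum (𝓞 K) in cofinite, SatakeFrobCompatibleAt ι π.1 ρ v) →
        ρ.toGaloisRep.IsIrreducible := by
    intro K _ _ n hcpt hn π ℓ _ ι ρ hgeo hρ
    obtain ⟨k, m, r, hr, hchar, -, hone⟩ :=
      stub_geometricConstituents stub_deRhamBlocks K ℓ n ρ hn hgeo
    by_cases hk1 : k = 1
    · exact hone hk1
    have hk0 : k ≠ 0 := by
      rintro rfl
      have h1 := hchar 1
      simp only [Finset.univ_eq_empty, Finset.prod_empty] at h1
      have hdeg : (FramedRep.charpoly ρ 1).natDegree = n := by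
        simp [FramedRep.charpoly, Matrix.charpoly_natDegree_eq_dim]
      rw [h1, natDegree_one] at hdeg
      omega
    have hk2 : 2 ≤ k := by omega
    have hσ : ∀ i, ∃ σ : CuspidalAutomorphicRepData (m i) K
        (isCompact_glFiniteIntegralLevel_holds (m i) K),
        ∀ᶠ v : HeightOneSpectrum (𝓞 K) in cofinite, SatakeFrobCompatibleAt ι σ.1 (r i) v := by
      intro i
      obtain ⟨σ, -, hcorr⟩ := hB K (m i) (isCompact_glFiniteIntegralLevel_holds (m i) K) (hr i).1 ℓ ι
        (r i) (hr i).2.1 (hr i).2.2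
      exact ⟨σ, hcorr⟩
    choose σ hσc using hσ
    refine (hIR K n hcpt π k m
      (fun i => isCompact_glFiniteIntegralLevel_holds (m i) K) σ hn hk2 (fun i => (hr i).1) ?_).elim
    have hall : ∀ᶠ v : HeightOneSpectrum (𝓞 K) in cofinite,
        ∀ i, SatakeFrobCompatibleAt ι (σ i).1 (r i) v :=
      Filter.eventually_all.mpr hσc
    filter_upwards [hρ, hall] with v hv hvi
    intro α hα
    obtain ⟨α₀, hα₀, -, hcp⟩ := hv
    obtain rfl : α = α₀ := AutomorphicRepData.hasSatakeParamAt_unique_holds π.1 hα hα₀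
    choose β hβ _hurβ hcpβ using hvi
    refine ⟨β, hβ, ?_⟩
    have hprod : ρ.HasFrobCharpolyAt v (∏ i, arithFrobPolyOfSatake ι v.residueCard 1 (β i)) := by
      intro 𝔓 h𝔓 τ hτ
      rw [hchar τ]
      exact Finset.prod_congr rfl fun i _ => hcpβ i 𝔓 h𝔓 τ hτ
    rw [← arithFrobPolyOfSatake_sum] at hprod
    have heq : arithFrobPolyOfSatake ι v.residueCard 1 α =
        arithFrobPolyOfSatake ι v.residueCard 1 (∑ i, β i) :=
      GaloisRep.HasFrobCharpolyAt.unique_holds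
        ((FramedGaloisRep.hasFrobCharpolyAt_toGaloisRep_iff v _ ρ).mpr hcp)
        ((FramedGaloisRep.hasFrobCharpolyAt_toGaloisRep_iff v _ ρ).mpr hprod)
    exact arithFrobPolyOfSatake_one_injective ι _ heq
  -- the re-typed summit: non-vacuity, then (A) ∧ (B) for EVERY pinned reciprocity datum
  intro F _ _
  obtain ⟨hne, hLF⟩ := hL F
  refine ⟨hne, fun 𝓡 n hn hcpt => ⟨?_, ?_⟩⟩
  · -- (A): the W-avatar is irreducible (bootstrap), corresponds for `𝓡` (LGC∀), and is unique up to conjugacy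
    intro π hLalg ℓ _ ι
    obtain ⟨ρ, hgeo, hρ⟩ := hW F n hcpt hn π hLalg ℓ ι
    have hirr : ρ.toGaloisRep.IsIrreducible := irr F n hcpt hn π ℓ ι ρ hgeo hρ
    have hcorr : Corresponds 𝓡 ι π.1 ρ := ⟨hρ, hLF 𝓡 n hcpt hn π hLalg ℓ ι ρ hirr hgeo hρ⟩
    refine ⟨ρ, hirr, hgeo, hcorr, fun ρ' hcorr' => ?_⟩
    have hev : ∀ᶠ v : HeightOneSpectrum (𝓞 F) in cofinite,
        ρ.IsUnramifiedAt v ∧ ρ'.IsUnramifiedAt v ∧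
          ∃ P : Polynomial (PadicAlgCl ℓ), ρ.HasFrobCharpolyAt v P ∧ ρ'.HasFrobCharpolyAt v P := by
      filter_upwards [hcorr.1, hcorr'.1] with v hv hv'
      obtain ⟨α, hα, hur, hcp⟩ := hv
      obtain ⟨α', hα', hur', hcp'⟩ := hv'
      obtain rfl : α = α' := AutomorphicRepData.hasSatakeParamAt_unique_holds π.1 hα hα'
      exact ⟨hur, hur', _, hcp, hcp'⟩
    exact (isIrreducible_and_isConjugate_of_common hirr hev).2
  · -- (B): B_w gives the L-algebraic cuspidal `π`, LGC∀ the compatibility at every place for `𝓡`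
    intro ℓ _ ι ρ hirr hgeo
    obtain ⟨π, hLalg, hρ⟩ := hB F n hcpt hn ℓ ι ρ hirr hgeo
    exact ⟨π, hLalg, hρ, hLF 𝓡 n hcpt hn π hLalg ℓ ι ρ hirr hgeo hρ⟩

/-- **The piece IR from the route's two Jacquet–Shalika items BY NAME** (its whole proof: the landed
`ReciprocityUpToIrreducibility.stub_isobaricRigidity`, p105601; the items' texts are δ-equal to the Literature named facts).
After the split a prover lands this as the proof of the child `IsobaricRigidityUnramified` … the day 13622 and 19093 close, or
closes the child outright from `CuspidalAutomorphicRepData.not_eventually_satake_eq_sum_of_JS` once the T0 debts are discharged.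
[cite: JacquetShalikaAJM1981II, Thm. 4.4] [cite: ArthurClozelAMS120, Ch. 3 §2 (2.2)–(2.3)] -/
theorem isobaricRigidityUnramified_of_JS (hJSb : PairLBoundaryJS) (hJSp : PairLPoleJS) : _Goal.stub_isobaricRigidityUnramified :=
  fun K _ _ n hcpt π k m hm σ hn hk hm0 => stub_isobaricRigidity hJSb hJSp K n hcpt π k m hm σ hn hk hm0

/-- By-name sanity check (an `example`, not a declaration): the five stubs feed the composition as they stand. -/
example : SectorComplement :=
  SectorComplement_of stub_weakExistence stub_weakAutomorphyOffEvenArtin stub_evenArtinPlaneOfMaass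
    stub_pairCompatibilityAllData stub_isobaricRigidityUnramified

end Summit.Langlands.Langlands.Cruxes.SectorComplement.Pieces

end
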